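/-
Copyright (c) 2026 the pub-hodgecm-mathlib formalisation cell (harness21).  Prover seat hodgecm-mathlib-LH3-p01 (g7): LH4-plan (g6) WORD #76 (P3d) «M1 LITERAL LAYER 4∕5 —
UNIT-ROW LITERAL ALGEBRA over `Q_b`» (retiring CENSUS-M1 bf2b9cff §3 row #11, literal half); 2026-09-02.
-/
import Literature.NumberTheory.Rogawski1990.DepthZeroKappaTransferTypeOneUnitRow   -- ★ the `e = ½` sibling: §1 `valuation_coeff_prod_sub_pow_lt_one` + the eigenframe sockets it opens
import Literature.NumberTheory.Rogawski1990.FlickerTorusTraceFrame               -- ★ p851724 (T2) `exists_generalLinearGroup_traceFrame`, (T3) `traceTorusElt_mul_frame`, (T5) `diag_mul_traceTorusElt`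
import HarnessLib

/-!
# The depth-zero κ-transfer, type (1): the literal package over the TRACE FRAME `Q_b` (`b + σb = 1`) — eigenframe, characteristic polynomial, deepness,
# regularity, compact centraliser at the trace literals `t_π^{(b)}(x₁,x₂,x₃)` and `t_1^{(b)}(x₁,x₂,x₃)`, with NO `2e = 1`
# (Rogawski 1990 Prop. 4.9.1; Flicker 1998 §2 Prop. 3; Jacobowitz 1962 §7)

Topic `NumberTheory/Rogawski1990`; namespace `Literature.NumberTheory.Rogawski1990`.  THEOREMS ONLY (no definition, no instance, no notation, no named fact,
no `sorry`); count-neutral; kernel lane `--supports stmt-HodgeConjecture-24833`.  Cell `pub/hodgecm-mathlib`, crux H413 = `stmt-HodgeConjecture-24833`, half A line LH4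
(dyadic pay-down; (D-UNR) PRINT by ruling D74′), LEAD T13-42 (4) price list, LH4-plan (g6) WORD #76 (P3d): the M1 «Flicker scalars» re-base (FINDING OF RECORD #4,
`F0/P3c/LH4/LH4-p01/g6/CENSUS-M1-flicker-scalars.v1.md` bf2b9cff §3 row #11), LITERAL LAYER 4∕5.

THIS FILE is the twin of ★ `DepthZeroKappaTransferTypeOneUnitRow` §2 :104–:201 and §3 :390–:487 — the five inputs `exists_frame`, `charpoly_map_eq`, `deep`,
`isRegularElt`, `compactSpace_centralizer` of ★ O8b `classOrbitalIntegral_eq_mul_strata_three_of_deep` at an element `t ∈ G′_v = U(H′)(L⁺_v)` carried by a congruence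
`ψ g = Tl g Tl⁻¹` onto a literal — with Flicker's `½`-literals `t_π(x₁,x₂,x₃) = (e(x₁+x₃), 0, −e(x₁−x₃)π; 0, x₂, 0; −e(x₁−x₃)π′, 0, e(x₁+x₃))` (`2e = 1`) REPLACED by the
TRACE LITERALS of ★ p851724 `FlickerTorusTraceFrame`:
* `t_π^{(b)}(x₁,x₂,x₃) := (x₁σb + x₃b, 0, π(x₁ − x₃); 0, x₂, 0; π′·bσb(x₁ − x₃), 0, x₁b + x₃σb)` (§2, eigenframe `diag(π,1,1)·Q_b`, ★ (T5) `diag_mul_traceTorusElt`), and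
* `t_1^{(b)}(x₁,x₂,x₃) := (x₁σb + x₃b, 0, x₁ − x₃; 0, x₂, 0; bσb(x₁ − x₃), 0, x₁b + x₃σb)` (§3, eigenframe `Q_b = (1 0 1; 0 1 0; b 0 −σb)`, ★ (T3) `traceTorusElt_mul_frame`),
where `σ = conjLocal` on `E_v = ∏_{w ∣ v} L_w` and `b + σb = 1` (at an inert-unramified dyadic place such a `b ∈ 𝒪_w` exists: ★ `UnramifiedQuadraticUnitTrace` ∕
`UnramifiedLocalConjDatum.trace`; at odd places `b = ½` recovers Flicker's literal up to the frame change).  The binder `h2e : 2 * e = 1` is DELETED throughout; the frame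
comes from ★ (T2) `exists_generalLinearGroup_traceFrame` (integral inverse `(σb 0 1; 0 1 0; b 0 −1)`), the characteristic polynomial, deepness, regularity and compact
centraliser then follow from the eigenframe VERBATIM as in the sibling (★ `valuation_coeff_prod_sub_pow_lt_one`, ★ `isRegularElt_of_eigenframe`, ★
`compactSpace_centralizer_of_eigenframe_of_smul_eq`).

EXCLUDED (on purpose, LH4-plan (g6) WORD #76): the UNIT-ROW STRATA SUMS ★ :211 `sum_ncard_rankStrata_eq_phiOne_of_congr` and ★ :497 `sum_ncard_rankStrata_eq_phiZero_of_congr`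
and the value `classOrbitalIntegral_eq_mul_strata_of_congr_flickerTorusElt(One)` — they call the Flicker COUNT ENGINE (`natCard_fixedPoints_unitaryInt_corner_eq_phiOne∕phiZero_adicCompletion`,
LAYER B of the census, FINDING #6: corner frame `hy : yσy = −2`, `LocalConjDatum` with `|2| = 1`) and wait for its re-cut in the `Q_b` corner; nothing here reads `2`, `e`, `x`, `y`.

HONEST READER LABEL: BANKED literal layer, consumers none live yet (the M1 re-base of `DepthZeroKappaTransferTypeOneAt`∕`…GSide`∕`…Socket` is undealt); HC_CM is proved only
modulo the 7 printed citations (2 remaining named inputs: hLiu418 = stmt-HodgeConjecture-24832, h413 = stmt-HodgeConjecture-24833) until rung 0 closes; count-neutral,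
pays no organ, opens no road.

## References
* [Rogawski1990] J. D. Rogawski, *Automorphic Representations of Unitary Groups in Three Variables* (1990), §3.6 p. 31, §4.9 Prop. 4.9.1 (b) p. 55, §14.2 p. 233.
* [Flicker1998UnitaryFL] Y. Z. Flicker, *Elementary proof of the fundamental lemma for a unitary group*, Canad. J. Math. 50 (1998), §2 Prop. 3 pp. 78–79, §3 p. 80.
* [Jacobowitz1962] R. Jacobowitz, *Hermitian forms over local fields*, Amer. J. Math. 84 (1962), §7 Thm. 7.1 (the trace condition `b + b̄ = 1`).
* [Kottwitz1986] R. E. Kottwitz, *Base change for unit elements of Hecke algebras*, Compositio Math. 60 (1986), §3.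
-/

set_option autoImplicit false

noncomputable section

open NumberField IsDedekindDomain Matrix Polynomial
open Literature.NumberTheory.Automorphic Literature.NumberTheory.Automorphic.UnitaryGroup
open scoped Matrix MatrixGroups ValuativeRel

namespace Literature.NumberTheory.Rogawski1990

/-! ## §1 A `GL₃` certificate for `diag(π, 1, 1)` -/

section Ring

variable {R : Type*} [CommRing R]

/-- `diag(π,1,1) ∈ GL₃(R)` when `ππ′ = 1` (inverse `diag(π′,1,1)`): the conjugator of the `π`-class `t_π^{(b)} = diag(π,1,1)·t_1^{(b)}·diag(π,1,1)⁻¹` (★ (T5)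
`diag_mul_traceTorusElt`). [cite: Flicker1998UnitaryFL, §2 Prop. 3 p. 79] -/
theorem exists_generalLinearGroup_diagPi {π π' : R} (hππ : π * π' = 1) :
    ∃ D : GL (Fin 3) R, (D : Matrix (Fin 3) (Fin 3) R) = !![π, 0, 0; 0, 1, 0; 0, 0, 1] ∧
      ((D⁻¹ : GL (Fin 3) R) : Matrix (Fin 3) (Fin 3) R) = !![π', 0, 0; 0, 1, 0; 0, 0, 1] := by
  have hπ'π : π' * π = 1 := by rw [mul_comm]; exact hππ
  have h1 : !![π, 0, 0; 0, 1, 0; 0, 0, (1 : R)] * !![π', 0, 0; 0, 1, 0; 0, 0, 1] = 1 := by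
    ext i j
    fin_cases i <;> fin_cases j <;> simp [Matrix.mul_apply, Fin.sum_univ_three, hππ]
  have h2 : !![π', 0, 0; 0, 1, 0; 0, 0, (1 : R)] * !![π, 0, 0; 0, 1, 0; 0, 0, 1] = 1 := by
    ext i j
    fin_cases i <;> fin_cases j <;> simp [Matrix.mul_apply, Fin.sum_univ_three, hπ'π]
  exact ⟨⟨_, _, h1, h2⟩, rfl, rfl⟩

end Ring

/-! ## §2 The θ̄ = 1 trace literals `t_π^{(b)}(x₁, x₂, x₃)`: frame `diag(π,1,1)·Q_b`, characteristic polynomial, deepness, regularity, compact centraliser -/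

section ThetaOne

variable (L : Type) [Field L] [NumberField L] [IsCMField L] (H' : Matrix (Fin 3) (Fin 3) L)
  {v : HeightOneSpectrum (𝓞 ↥(maximalRealSubfield L))}

/-- **THE EIGENFRAME OF `t` (trace literal, θ̄ = 1)**: if `ψ t = Tl t Tl⁻¹` is the trace literal `t_π^{(b)}(x₁,x₂,x₃)` (`b + σb = 1`, `ππ′ = 1`), then
`t · Q = Q · diag(x₁,x₂,x₃)` for the frame `Q = Tl⁻¹ · diag(π,1,1) · Q_b` (★ (T5) `diag_mul_traceTorusElt`, ★ (T3) `traceTorusElt_mul_frame`, ★ (T2) the integral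
inverse of `Q_b`) — the twin of ★ `exists_frame_of_congr_flickerTorusElt` with NO `2e = 1`. [cite: Flicker1998UnitaryFL, §2 Prop. 3 pp. 78–79] [cite: Jacobowitz1962, §7 Thm. 7.1] -/
theorem exists_frame_of_congr_traceTorusEltPi {b π π' x₁ x₂ x₃ : LocalRing L v} (hb : b + conjLocal L (IsCMField.complexConj L) v b = 1) (hππ : π * π' = 1)
    (Tl : GL (Fin 3) (LocalRing L v))
    (ψ : ↥(UnitaryGroup.«local» L (IsCMField.complexConj L) 3 H' v) ≃ₜ*
        ↥(UnitaryGroup.«local» L (IsCMField.complexConj L) 3 (Matrix.of fun i j : Fin 3 => if i.val + j.val + 1 = 3 then (1 : L) else 0) v))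
    (t : (cmDatum L 3 H').Local v) (hψ : ∀ g, (ψ g).val = Tl * g.val * Tl⁻¹)
    (hlit : (ψ t).val.val = !![x₁ * conjLocal L (IsCMField.complexConj L) v b + x₃ * b, 0, π * (x₁ - x₃); 0, x₂, 0;
      π' * (b * conjLocal L (IsCMField.complexConj L) v b * (x₁ - x₃)), 0, x₁ * b + x₃ * conjLocal L (IsCMField.complexConj L) v b]) :
    ∃ Q : GL (Fin 3) (LocalRing L v), (t.val.val : Matrix (Fin 3) (Fin 3) (LocalRing L v)) * Q.val = Q.val * diagonal ![x₁, x₂, x₃] := by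
  obtain ⟨Qb, hQb, -⟩ := exists_generalLinearGroup_traceFrame (conjLocal L (IsCMField.complexConj L) v) hb
  obtain ⟨D, hD, -⟩ := exists_generalLinearGroup_diagPi (R := LocalRing L v) hππ
  -- the frame `F = diag(π,1,1) · Q_b` as ONE invertible matrix
  obtain ⟨F, hF⟩ : ∃ F : GL (Fin 3) (LocalRing L v), F.val = !![π, 0, 0; 0, 1, 0; 0, 0, 1] *
      !![(1 : LocalRing L v), 0, 1; 0, 1, 0; b, 0, -conjLocal L (IsCMField.complexConj L) v b] :=
    ⟨D * Qb, by rw [Units.val_mul, hD, hQb]⟩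
  have htval : (t.val.val : Matrix (Fin 3) (Fin 3) (LocalRing L v)) = Tl⁻¹.val * (ψ t).val.val * Tl.val := by
    rw [hψ t, Units.val_mul, Units.val_mul, ← Matrix.mul_assoc, ← Matrix.mul_assoc, ← Units.val_mul, inv_mul_cancel, Units.val_one, Matrix.one_mul,
      Matrix.mul_assoc, ← Units.val_mul, inv_mul_cancel, Units.val_one, Matrix.mul_one]
  -- the literal's eigenframe: `t_π^{(b)} · (diag(π,1,1) Q_b) = (diag(π,1,1) Q_b) · diag(x₁,x₂,x₃)` (★ (T5) then ★ (T3))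
  have hframe : (ψ t).val.val * F.val = F.val * diagonal ![x₁, x₂, x₃] := by
    rw [hlit, hF, Flicker1998.diagonal_fin_three, ← Matrix.mul_assoc,
      ← diag_mul_traceTorusElt (conjLocal L (IsCMField.complexConj L) v) hππ b x₁ x₂ x₃, Matrix.mul_assoc,
      traceTorusElt_mul_frame (conjLocal L (IsCMField.complexConj L) v) hb x₁ x₂ x₃, Matrix.mul_assoc]
  have hlit' : (ψ t).val.val = F.val * diagonal ![x₁, x₂, x₃] * (F⁻¹).val := by
    rw [← hframe, Matrix.mul_assoc, ← Units.val_mul, mul_inv_cancel, Units.val_one, Matrix.mul_one]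
  refine ⟨Tl⁻¹ * F, ?_⟩
  rw [htval, Units.val_mul, hlit', Matrix.mul_assoc, Matrix.mul_assoc, Matrix.mul_assoc, ← Matrix.mul_assoc Tl.val, ← Units.val_mul, mul_inv_cancel,
    Units.val_one, Matrix.one_mul, ← Units.val_mul F⁻¹, inv_mul_cancel, Units.val_one, Matrix.mul_one, ← Matrix.mul_assoc]

/-- **`χ_{t,w} = (X − x_{1,w})(X − x_{2,w})(X − x_{3,w})`** for `t` congruent to the trace literal `t_π^{(b)}(x₁,x₂,x₃)` (conjugation does not change `charpoly`;
`charpoly` of a diagonal) — twin of ★ `charpoly_map_eq_of_congr_flickerTorusElt`, NO `2e = 1`. [cite: Flicker1998UnitaryFL, §2 Prop. 3 p. 78] -/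
theorem charpoly_map_eq_of_congr_traceTorusEltPi (w : PlacesOver L v) {b π π' x₁ x₂ x₃ : LocalRing L v}
    (hb : b + conjLocal L (IsCMField.complexConj L) v b = 1) (hππ : π * π' = 1)
    (Tl : GL (Fin 3) (LocalRing L v))
    (ψ : ↥(UnitaryGroup.«local» L (IsCMField.complexConj L) 3 H' v) ≃ₜ*
        ↥(UnitaryGroup.«local» L (IsCMField.complexConj L) 3 (Matrix.of fun i j : Fin 3 => if i.val + j.val + 1 = 3 then (1 : L) else 0) v))
    (t : (cmDatum L 3 H').Local v) (hψ : ∀ g, (ψ g).val = Tl * g.val * Tl⁻¹)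
    (hlit : (ψ t).val.val = !![x₁ * conjLocal L (IsCMField.complexConj L) v b + x₃ * b, 0, π * (x₁ - x₃); 0, x₂, 0;
      π' * (b * conjLocal L (IsCMField.complexConj L) v b * (x₁ - x₃)), 0, x₁ * b + x₃ * conjLocal L (IsCMField.complexConj L) v b]) :
    (((t.val : GL (Fin 3) (LocalRing L v)).val.map (Pi.evalRingHom (fun w' : PlacesOver L v => w'.1.adicCompletion L) w))).charpoly =
      (X - C (x₁ w)) * (X - C (x₂ w)) * (X - C (x₃ w)) := by
  obtain ⟨Q, hQ⟩ := exists_frame_of_congr_traceTorusEltPi L H' hb hππ Tl ψ t hψ hlit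
  have ht : (t.val.val : Matrix (Fin 3) (Fin 3) (LocalRing L v)) = Q.val * diagonal ![x₁, x₂, x₃] * Q.val⁻¹ := by
    rw [← hQ, Matrix.mul_assoc, Matrix.mul_nonsing_inv _ (Matrix.isUnits_det_units Q), Matrix.mul_one]
  rw [Matrix.charpoly_map, ht, Matrix.charpoly_units_conj, Matrix.charpoly_diagonal, Polynomial.map_prod, Fin.prod_univ_three]
  simp only [Polynomial.map_sub, Polynomial.map_X, Polynomial.map_C, Matrix.cons_val_zero, Matrix.cons_val_one, Matrix.cons_val]
  rfl

/-- **DEEPNESS**: if the eigenvalues of the trace literal are ≡ 1 (`|x_{i,w} − 1|_w < 1`), then `χ_{t,w} ≡ (X − 1)³ (mod 𝔪_w)` coefficientwise — the `ht` input of ★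
`classOrbitalIntegral_eq_mul_strata_three_of_deep`; twin of ★ `deep_of_congr_flickerTorusElt`, NO `2e = 1`. [cite: Kottwitz1986, §3] [cite: Rogawski1990, §4.9 p. 54] -/
theorem deep_of_congr_traceTorusEltPi (w : PlacesOver L v) {b π π' x₁ x₂ x₃ : LocalRing L v}
    (hb : b + conjLocal L (IsCMField.complexConj L) v b = 1) (hππ : π * π' = 1)
    (Tl : GL (Fin 3) (LocalRing L v))
    (ψ : ↥(UnitaryGroup.«local» L (IsCMField.complexConj L) 3 H' v) ≃ₜ*
        ↥(UnitaryGroup.«local» L (IsCMField.complexConj L) 3 (Matrix.of fun i j : Fin 3 => if i.val + j.val + 1 = 3 then (1 : L) else 0) v))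
    (t : (cmDatum L 3 H').Local v) (hψ : ∀ g, (ψ g).val = Tl * g.val * Tl⁻¹)
    (hlit : (ψ t).val.val = !![x₁ * conjLocal L (IsCMField.complexConj L) v b + x₃ * b, 0, π * (x₁ - x₃); 0, x₂, 0;
      π' * (b * conjLocal L (IsCMField.complexConj L) v b * (x₁ - x₃)), 0, x₁ * b + x₃ * conjLocal L (IsCMField.complexConj L) v b])
    (hd₁ : Valued.v (x₁ w - 1) < 1) (hd₂ : Valued.v (x₂ w - 1) < 1) (hd₃ : Valued.v (x₃ w - 1) < 1) :
    ∀ m : ℕ, ValuativeRel.valuation (w.1.adicCompletion L)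
      (((((t.val : GL (Fin 3) (LocalRing L v)).val.map (Pi.evalRingHom (fun w' : PlacesOver L v => w'.1.adicCompletion L) w))).charpoly -
        (Polynomial.X - 1) ^ 3).coeff m) < 1 := by
  have hiso := ValuativeRel.isEquiv (ValuativeRel.valuation (w.1.adicCompletion L))
    (Valued.v : Valuation (w.1.adicCompletion L) (WithZero (Multiplicative ℤ)))
  intro m
  rw [charpoly_map_eq_of_congr_traceTorusEltPi L H' w hb hππ Tl ψ t hψ hlit]
  exact valuation_coeff_prod_sub_pow_lt_one _ (hiso.lt_one_iff_lt_one.2 hd₁) (hiso.lt_one_iff_lt_one.2 hd₂) (hiso.lt_one_iff_lt_one.2 hd₃) m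

/-- **REGULARITY**: `t` congruent to the trace literal `t_π^{(b)}(x₁,x₂,x₃)` with `x_i` pairwise distinct is a regular element (★ `isRegularElt_of_eigenframe`) — twin of ★
`isRegularElt_of_congr_flickerTorusElt`, NO `2e = 1`. [cite: Flicker1998UnitaryFL, §2 Prop. 3 p. 78] [cite: Rogawski1990, §4.9 p. 54] -/
theorem isRegularElt_of_congr_traceTorusEltPi (w : PlacesOver L v) (hw : IsCMField.complexConj L • w.1 = w.1)
    {b π π' x₁ x₂ x₃ : LocalRing L v} (hb : b + conjLocal L (IsCMField.complexConj L) v b = 1) (hππ : π * π' = 1)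
    (h₁₂ : x₁ ≠ x₂) (h₂₃ : x₂ ≠ x₃) (h₁₃ : x₁ ≠ x₃)
    (Tl : GL (Fin 3) (LocalRing L v))
    (ψ : ↥(UnitaryGroup.«local» L (IsCMField.complexConj L) 3 H' v) ≃ₜ*
        ↥(UnitaryGroup.«local» L (IsCMField.complexConj L) 3 (Matrix.of fun i j : Fin 3 => if i.val + j.val + 1 = 3 then (1 : L) else 0) v))
    (t : (cmDatum L 3 H').Local v) (hψ : ∀ g, (ψ g).val = Tl * g.val * Tl⁻¹)
    (hlit : (ψ t).val.val = !![x₁ * conjLocal L (IsCMField.complexConj L) v b + x₃ * b, 0, π * (x₁ - x₃); 0, x₂, 0;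
      π' * (b * conjLocal L (IsCMField.complexConj L) v b * (x₁ - x₃)), 0, x₁ * b + x₃ * conjLocal L (IsCMField.complexConj L) v b]) :
    IsRegularElt (t.val : GL (Fin 3) (LocalRing L v)) := by
  obtain ⟨Q, hQ⟩ := exists_frame_of_congr_traceTorusEltPi L H' hb hππ Tl ψ t hψ hlit
  have hu : Function.Injective ![x₁, x₂, x₃] := by
    intro i j hij
    fin_cases i <;> fin_cases j
    all_goals first | rfl | (exfalso; revert hij; simp [h₁₂, h₂₃, h₁₃, h₁₂.symm, h₂₃.symm, h₁₃.symm])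
  exact isRegularElt_of_eigenframe L H' w hw t hQ hu

/-- **COMPACT CENTRALISER**: `t` congruent to the trace literal `t_π^{(b)}(x₁,x₂,x₃)` with `x_i` pairwise distinct of norm one has compact centraliser in `G′_v`
(★ `compactSpace_centralizer_of_eigenframe_of_smul_eq`) — twin of ★ `compactSpace_centralizer_of_congr_flickerTorusElt`, NO `2e = 1`.
[cite: Flicker1998UnitaryFL, §2 Prop. 3 p. 78] [cite: Rogawski1990, §3.6 p. 31; §4.9 p. 54] -/
theorem compactSpace_centralizer_of_congr_traceTorusEltPi (hH' : (H'.map (IsCMField.complexConj L))ᵀ = H') (hH'u : IsUnit H')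
    (w : PlacesOver L v) (hw : IsCMField.complexConj L • w.1 = w.1)
    {b π π' x₁ x₂ x₃ : LocalRing L v} (hb : b + conjLocal L (IsCMField.complexConj L) v b = 1) (hππ : π * π' = 1)
    (hx₁ : conjLocal L (IsCMField.complexConj L) v x₁ * x₁ = 1) (hx₂ : conjLocal L (IsCMField.complexConj L) v x₂ * x₂ = 1)
    (hx₃ : conjLocal L (IsCMField.complexConj L) v x₃ * x₃ = 1) (h₁₂ : x₁ ≠ x₂) (h₂₃ : x₂ ≠ x₃) (h₁₃ : x₁ ≠ x₃)
    (Tl : GL (Fin 3) (LocalRing L v))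
    (ψ : ↥(UnitaryGroup.«local» L (IsCMField.complexConj L) 3 H' v) ≃ₜ*
        ↥(UnitaryGroup.«local» L (IsCMField.complexConj L) 3 (Matrix.of fun i j : Fin 3 => if i.val + j.val + 1 = 3 then (1 : L) else 0) v))
    (t : (cmDatum L 3 H').Local v) (hψ : ∀ g, (ψ g).val = Tl * g.val * Tl⁻¹)
    (hlit : (ψ t).val.val = !![x₁ * conjLocal L (IsCMField.complexConj L) v b + x₃ * b, 0, π * (x₁ - x₃); 0, x₂, 0;
      π' * (b * conjLocal L (IsCMField.complexConj L) v b * (x₁ - x₃)), 0, x₁ * b + x₃ * conjLocal L (IsCMField.complexConj L) v b]) :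
    CompactSpace (Subgroup.centralizer ({t} : Set ((cmDatum L 3 H').Local v))) := by
  obtain ⟨Q, hQ⟩ := exists_frame_of_congr_traceTorusEltPi L H' hb hππ Tl ψ t hψ hlit
  have hu : Function.Injective ![x₁, x₂, x₃] := by
    intro i j hij
    fin_cases i <;> fin_cases j
    all_goals first | rfl | (exfalso; revert hij; simp [h₁₂, h₂₃, h₁₃, h₁₂.symm, h₂₃.symm, h₁₃.symm])
  have hu1 : ∀ i, conjLocal L (IsCMField.complexConj L) v (![x₁, x₂, x₃] i) * ![x₁, x₂, x₃] i = 1 := by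
    intro i; fin_cases i
    · exact hx₁
    · exact hx₂
    · exact hx₃
  have hH'c : (H'.map (cmConjRingHom L))ᵀ = H' := by
    have e1 : H'.map (cmConjRingHom L) = H'.map (IsCMField.complexConj L) := by
      ext i j; simp [Matrix.map_apply, cmConjRingHom_apply]
    rw [e1]; exact hH'
  have hdet : H'.det ≠ 0 := (Matrix.isUnit_iff_isUnit_det _ |>.1 hH'u).ne_zero
  exact compactSpace_centralizer_of_eigenframe_of_smul_eq L w hw H' hH'c hdet t hQ hu hu1

end ThetaOne

/-! ## §3 The θ̄ = 0 trace literal `t_1^{(b)}(x₁, x₂, x₃)`: frame `Q_b`, characteristic polynomial, deepness, regularity, compact centraliser -/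

section ThetaZero

variable (L : Type) [Field L] [NumberField L] [IsCMField L] (H' : Matrix (Fin 3) (Fin 3) L)
  {v : HeightOneSpectrum (𝓞 ↥(maximalRealSubfield L))}

/-- **THE EIGENFRAME OF `t` (trace literal, θ̄ = 0)**: if `ψ t = Tl t Tl⁻¹` is the trace literal `t_1^{(b)}(x₁,x₂,x₃)` (`b + σb = 1`), then `t · Q = Q · diag(x₁,x₂,x₃)`
for the frame `Q = Tl⁻¹ · Q_b`, `Q_b = (1 0 1; 0 1 0; b 0 −σb)` (★ (T3) `traceTorusElt_mul_frame`, ★ (T2) `exists_generalLinearGroup_traceFrame`) — the twin of ★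
`exists_frame_of_congr_flickerTorusEltOne` with NO `2e = 1`. [cite: Flicker1998UnitaryFL, §2 Prop. 3 pp. 78–79] [cite: Jacobowitz1962, §7 Thm. 7.1] -/
theorem exists_frame_of_congr_traceTorusElt {b x₁ x₂ x₃ : LocalRing L v} (hb : b + conjLocal L (IsCMField.complexConj L) v b = 1)
    (Tl : GL (Fin 3) (LocalRing L v))
    (ψ : ↥(UnitaryGroup.«local» L (IsCMField.complexConj L) 3 H' v) ≃ₜ*
        ↥(UnitaryGroup.«local» L (IsCMField.complexConj L) 3 (Matrix.of fun i j : Fin 3 => if i.val + j.val + 1 = 3 then (1 : L) else 0) v))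
    (t : (cmDatum L 3 H').Local v) (hψ : ∀ g, (ψ g).val = Tl * g.val * Tl⁻¹)
    (hlit : (ψ t).val.val = !![x₁ * conjLocal L (IsCMField.complexConj L) v b + x₃ * b, 0, x₁ - x₃; 0, x₂, 0;
      b * conjLocal L (IsCMField.complexConj L) v b * (x₁ - x₃), 0, x₁ * b + x₃ * conjLocal L (IsCMField.complexConj L) v b]) :
    ∃ Q : GL (Fin 3) (LocalRing L v), (t.val.val : Matrix (Fin 3) (Fin 3) (LocalRing L v)) * Q.val = Q.val * diagonal ![x₁, x₂, x₃] := by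
  obtain ⟨F, hF, -⟩ := exists_generalLinearGroup_traceFrame (conjLocal L (IsCMField.complexConj L) v) hb
  have htval : (t.val.val : Matrix (Fin 3) (Fin 3) (LocalRing L v)) = Tl⁻¹.val * (ψ t).val.val * Tl.val := by
    rw [hψ t, Units.val_mul, Units.val_mul, ← Matrix.mul_assoc, ← Matrix.mul_assoc, ← Units.val_mul, inv_mul_cancel, Units.val_one, Matrix.one_mul,
      Matrix.mul_assoc, ← Units.val_mul, inv_mul_cancel, Units.val_one, Matrix.mul_one]
  -- the literal's eigenframe: `t_1^{(b)} · Q_b = Q_b · diag(x₁,x₂,x₃)` (★ (T3))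
  have hframe : (ψ t).val.val * F.val = F.val * diagonal ![x₁, x₂, x₃] := by
    rw [hlit, hF, Flicker1998.diagonal_fin_three, traceTorusElt_mul_frame (conjLocal L (IsCMField.complexConj L) v) hb x₁ x₂ x₃]
  have hlit' : (ψ t).val.val = F.val * diagonal ![x₁, x₂, x₃] * (F⁻¹).val := by
    rw [← hframe, Matrix.mul_assoc, ← Units.val_mul, mul_inv_cancel, Units.val_one, Matrix.mul_one]
  refine ⟨Tl⁻¹ * F, ?_⟩
  rw [htval, Units.val_mul, hlit', Matrix.mul_assoc, Matrix.mul_assoc, Matrix.mul_assoc, ← Matrix.mul_assoc Tl.val, ← Units.val_mul, mul_inv_cancel,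
    Units.val_one, Matrix.one_mul, ← Units.val_mul F⁻¹, inv_mul_cancel, Units.val_one, Matrix.mul_one, ← Matrix.mul_assoc]

/-- **`χ_{t,w} = (X − x_{1,w})(X − x_{2,w})(X − x_{3,w})`** for `t` congruent to the trace literal `t_1^{(b)}(x₁,x₂,x₃)` — twin of ★ `charpoly_map_eq_of_congr_flickerTorusEltOne`,
NO `2e = 1`. [cite: Flicker1998UnitaryFL, §2 Prop. 3 p. 78] -/
theorem charpoly_map_eq_of_congr_traceTorusElt (w : PlacesOver L v) {b x₁ x₂ x₃ : LocalRing L v} (hb : b + conjLocal L (IsCMField.complexConj L) v b = 1)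
    (Tl : GL (Fin 3) (LocalRing L v))
    (ψ : ↥(UnitaryGroup.«local» L (IsCMField.complexConj L) 3 H' v) ≃ₜ*
        ↥(UnitaryGroup.«local» L (IsCMField.complexConj L) 3 (Matrix.of fun i j : Fin 3 => if i.val + j.val + 1 = 3 then (1 : L) else 0) v))
    (t : (cmDatum L 3 H').Local v) (hψ : ∀ g, (ψ g).val = Tl * g.val * Tl⁻¹)
    (hlit : (ψ t).val.val = !![x₁ * conjLocal L (IsCMField.complexConj L) v b + x₃ * b, 0, x₁ - x₃; 0, x₂, 0;
      b * conjLocal L (IsCMField.complexConj L) v b * (x₁ - x₃), 0, x₁ * b + x₃ * conjLocal L (IsCMField.complexConj L) v b]) :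
    (((t.val : GL (Fin 3) (LocalRing L v)).val.map (Pi.evalRingHom (fun w' : PlacesOver L v => w'.1.adicCompletion L) w))).charpoly =
      (X - C (x₁ w)) * (X - C (x₂ w)) * (X - C (x₃ w)) := by
  obtain ⟨Q, hQ⟩ := exists_frame_of_congr_traceTorusElt L H' hb Tl ψ t hψ hlit
  have ht : (t.val.val : Matrix (Fin 3) (Fin 3) (LocalRing L v)) = Q.val * diagonal ![x₁, x₂, x₃] * Q.val⁻¹ := by
    rw [← hQ, Matrix.mul_assoc, Matrix.mul_nonsing_inv _ (Matrix.isUnits_det_units Q), Matrix.mul_one]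
  rw [Matrix.charpoly_map, ht, Matrix.charpoly_units_conj, Matrix.charpoly_diagonal, Polynomial.map_prod, Fin.prod_univ_three]
  simp only [Polynomial.map_sub, Polynomial.map_X, Polynomial.map_C, Matrix.cons_val_zero, Matrix.cons_val_one, Matrix.cons_val]
  rfl

/-- **DEEPNESS**: if the eigenvalues of the trace literal are ≡ 1 (`|x_{i,w} − 1|_w < 1`), then `χ_{t,w} ≡ (X − 1)³ (mod 𝔪_w)` coefficientwise — twin of ★
`deep_of_congr_flickerTorusEltOne`, NO `2e = 1`. [cite: Kottwitz1986, §3] [cite: Rogawski1990, §4.9 p. 54] -/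
theorem deep_of_congr_traceTorusElt (w : PlacesOver L v) {b x₁ x₂ x₃ : LocalRing L v} (hb : b + conjLocal L (IsCMField.complexConj L) v b = 1)
    (Tl : GL (Fin 3) (LocalRing L v))
    (ψ : ↥(UnitaryGroup.«local» L (IsCMField.complexConj L) 3 H' v) ≃ₜ*
        ↥(UnitaryGroup.«local» L (IsCMField.complexConj L) 3 (Matrix.of fun i j : Fin 3 => if i.val + j.val + 1 = 3 then (1 : L) else 0) v))
    (t : (cmDatum L 3 H').Local v) (hψ : ∀ g, (ψ g).val = Tl * g.val * Tl⁻¹)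
    (hlit : (ψ t).val.val = !![x₁ * conjLocal L (IsCMField.complexConj L) v b + x₃ * b, 0, x₁ - x₃; 0, x₂, 0;
      b * conjLocal L (IsCMField.complexConj L) v b * (x₁ - x₃), 0, x₁ * b + x₃ * conjLocal L (IsCMField.complexConj L) v b])
    (hd₁ : Valued.v (x₁ w - 1) < 1) (hd₂ : Valued.v (x₂ w - 1) < 1) (hd₃ : Valued.v (x₃ w - 1) < 1) :
    ∀ m : ℕ, ValuativeRel.valuation (w.1.adicCompletion L)
      (((((t.val : GL (Fin 3) (LocalRing L v)).val.map (Pi.evalRingHom (fun w' : PlacesOver L v => w'.1.adicCompletion L) w))).charpoly -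
        (Polynomial.X - 1) ^ 3).coeff m) < 1 := by
  have hiso := ValuativeRel.isEquiv (ValuativeRel.valuation (w.1.adicCompletion L))
    (Valued.v : Valuation (w.1.adicCompletion L) (WithZero (Multiplicative ℤ)))
  intro m
  rw [charpoly_map_eq_of_congr_traceTorusElt L H' w hb Tl ψ t hψ hlit]
  exact valuation_coeff_prod_sub_pow_lt_one _ (hiso.lt_one_iff_lt_one.2 hd₁) (hiso.lt_one_iff_lt_one.2 hd₂) (hiso.lt_one_iff_lt_one.2 hd₃) m

/-- **REGULARITY**: `t` congruent to the trace literal `t_1^{(b)}(x₁,x₂,x₃)` with `x_i` pairwise distinct is a regular element (★ `isRegularElt_of_eigenframe`) — twin of ★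
`isRegularElt_of_congr_flickerTorusEltOne`, NO `2e = 1`. [cite: Flicker1998UnitaryFL, §2 Prop. 3 p. 78] [cite: Rogawski1990, §4.9 p. 54] -/
theorem isRegularElt_of_congr_traceTorusElt (w : PlacesOver L v) (hw : IsCMField.complexConj L • w.1 = w.1)
    {b x₁ x₂ x₃ : LocalRing L v} (hb : b + conjLocal L (IsCMField.complexConj L) v b = 1) (h₁₂ : x₁ ≠ x₂) (h₂₃ : x₂ ≠ x₃) (h₁₃ : x₁ ≠ x₃)
    (Tl : GL (Fin 3) (LocalRing L v))
    (ψ : ↥(UnitaryGroup.«local» L (IsCMField.complexConj L) 3 H' v) ≃ₜ*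
        ↥(UnitaryGroup.«local» L (IsCMField.complexConj L) 3 (Matrix.of fun i j : Fin 3 => if i.val + j.val + 1 = 3 then (1 : L) else 0) v))
    (t : (cmDatum L 3 H').Local v) (hψ : ∀ g, (ψ g).val = Tl * g.val * Tl⁻¹)
    (hlit : (ψ t).val.val = !![x₁ * conjLocal L (IsCMField.complexConj L) v b + x₃ * b, 0, x₁ - x₃; 0, x₂, 0;
      b * conjLocal L (IsCMField.complexConj L) v b * (x₁ - x₃), 0, x₁ * b + x₃ * conjLocal L (IsCMField.complexConj L) v b]) :
    IsRegularElt (t.val : GL (Fin 3) (LocalRing L v)) := by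
  obtain ⟨Q, hQ⟩ := exists_frame_of_congr_traceTorusElt L H' hb Tl ψ t hψ hlit
  have hu : Function.Injective ![x₁, x₂, x₃] := by
    intro i j hij
    fin_cases i <;> fin_cases j
    all_goals first | rfl | (exfalso; revert hij; simp [h₁₂, h₂₃, h₁₃, h₁₂.symm, h₂₃.symm, h₁₃.symm])
  exact isRegularElt_of_eigenframe L H' w hw t hQ hu

/-- **COMPACT CENTRALISER**: `t` congruent to the trace literal `t_1^{(b)}(x₁,x₂,x₃)` with `x_i` pairwise distinct of norm one has compact centraliser in `G′_v`
(★ `compactSpace_centralizer_of_eigenframe_of_smul_eq`) — twin of ★ `compactSpace_centralizer_of_congr_flickerTorusEltOne`, NO `2e = 1`.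
[cite: Flicker1998UnitaryFL, §2 Prop. 3 p. 78] [cite: Rogawski1990, §3.6 p. 31; §4.9 p. 54] -/
theorem compactSpace_centralizer_of_congr_traceTorusElt (hH' : (H'.map (IsCMField.complexConj L))ᵀ = H') (hH'u : IsUnit H')
    (w : PlacesOver L v) (hw : IsCMField.complexConj L • w.1 = w.1)
    {b x₁ x₂ x₃ : LocalRing L v} (hb : b + conjLocal L (IsCMField.complexConj L) v b = 1)
    (hx₁ : conjLocal L (IsCMField.complexConj L) v x₁ * x₁ = 1) (hx₂ : conjLocal L (IsCMField.complexConj L) v x₂ * x₂ = 1)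
    (hx₃ : conjLocal L (IsCMField.complexConj L) v x₃ * x₃ = 1) (h₁₂ : x₁ ≠ x₂) (h₂₃ : x₂ ≠ x₃) (h₁₃ : x₁ ≠ x₃)
    (Tl : GL (Fin 3) (LocalRing L v))
    (ψ : ↥(UnitaryGroup.«local» L (IsCMField.complexConj L) 3 H' v) ≃ₜ*
        ↥(UnitaryGroup.«local» L (IsCMField.complexConj L) 3 (Matrix.of fun i j : Fin 3 => if i.val + j.val + 1 = 3 then (1 : L) else 0) v))
    (t : (cmDatum L 3 H').Local v) (hψ : ∀ g, (ψ g).val = Tl * g.val * Tl⁻¹)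
    (hlit : (ψ t).val.val = !![x₁ * conjLocal L (IsCMField.complexConj L) v b + x₃ * b, 0, x₁ - x₃; 0, x₂, 0;
      b * conjLocal L (IsCMField.complexConj L) v b * (x₁ - x₃), 0, x₁ * b + x₃ * conjLocal L (IsCMField.complexConj L) v b]) :
    CompactSpace (Subgroup.centralizer ({t} : Set ((cmDatum L 3 H').Local v))) := by
  obtain ⟨Q, hQ⟩ := exists_frame_of_congr_traceTorusElt L H' hb Tl ψ t hψ hlit
  have hu : Function.Injective ![x₁, x₂, x₃] := by
    intro i j hij
    fin_cases i <;> fin_cases j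
    all_goals first | rfl | (exfalso; revert hij; simp [h₁₂, h₂₃, h₁₃, h₁₂.symm, h₂₃.symm, h₁₃.symm])
  have hu1 : ∀ i, conjLocal L (IsCMField.complexConj L) v (![x₁, x₂, x₃] i) * ![x₁, x₂, x₃] i = 1 := by
    intro i; fin_cases i
    · exact hx₁
    · exact hx₂
    · exact hx₃
  have hH'c : (H'.map (cmConjRingHom L))ᵀ = H' := by
    have e1 : H'.map (cmConjRingHom L) = H'.map (IsCMField.complexConj L) := by
      ext i j; simp [Matrix.map_apply, cmConjRingHom_apply]
    rw [e1]; exact hH'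
  have hdet : H'.det ≠ 0 := (Matrix.isUnit_iff_isUnit_det _ |>.1 hH'u).ne_zero
  exact compactSpace_centralizer_of_eigenframe_of_smul_eq L w hw H' hH'c hdet t hQ hu hu1

end ThetaZero

end Literature.NumberTheory.Rogawski1990

end
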